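import Summits.FinalStateConjecture.FinalStateConjecture.Theses.ClusterCompleteness
import Literature.Geometry.Lorentzian.CoordCurvature
import HarnessLib

/-!
# Crux `ClusterCompleteness.OmegaLimitMultiKerr` (stmt-FinalStateConjecture-17639), line `Sketch` v6 —
# stub `stub_eraHorizonNull` (child 2 `TameEraRecurs`, stub 1): null inner boundaries of a HORIZON-REGULAR era

Skeleton v6 (crux dir `Lines/Sketch.lean`; lead c3 after the wave-1 stub-worker audit, 2026-08-17). At v3/v4 the
stub asserted, for EVERY hole chart of EVERY tame era, that the red-shift scalar `G^{rr} = dr(G♯dr)` of the chart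
metric `G = Ψᵢ^*g` (lab Kerr–Schild coordinates: `deviationExtend + boostedKerrBilin`) tends to `0` at the inner
boundary `{r = r₊(Mᵢ, aᵢ)}` uniformly in chart time. The audit found that no era clause ties a hole chart's inner
boundary to `∂O` once other charts cover its collar (in the Minkowski MGHD with `U₀ = ⊤`, `Ψ₀ = id`, exhaustion is
vacuous and any `1/8`-anchored, `C^{k+4}`-bounded late Kerr chart into `ℝ⁴` completes an `N = 1` tame era), so the
v3 text is equivalent to an unproved `C⁰`-rigidity of Kerr horizon collars. v5/v6 thread the LINEAR COLLAR BOUND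
`|G^{rr}| ≤ κ₁ (r − r₊)` — the two-sided form of child 1's red-shift clause, produced by `stub_genericTameEraRedShift`
for the (honest, horizon-normalised) era it builds — into the era consumed by child 2 and into this stub's
hypothesis. The stub is then the corollary proved here: with `δ := min δ₁ (ε / (|κ₁| + 1))`, on the `δ`-collar
`0 ≤ r − r₊ ≤ δ` (collar points lie in the exterior `{max r₊ 0 < r}`), hence `|G^{rr}| ≤ κ₁ (r − r₊) ≤ |κ₁| δ ≤ ε`.
Proof by the wave-1 stub-worker (work file `stubs/stub_eraHorizonNull.lean`), landed by the lead verbatim.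
-/

set_option linter.dupNamespace false

noncomputable section

open scoped Manifold ContDiff Topology ENNReal
open Set Filter Function TopologicalSpace

namespace Summit.FinalStateConjecture.FinalStateConjecture.Theorems.ClusterCompleteness

open Literature.Geometry.Lorentzian

/-- **Stub `stub_eraHorizonNull` (line `Sketch` v6, child 2 stub 1): in a horizon-regular tame era the inner
boundary of every hole chart is null for the chart metric** — `∀ ε > 0 ∃ δ > 0`, uniformly in chart time `τ > τ₀`,
`|dr(G♯dr)| ≤ ε` on the collar `{t* = τ, r₊ < r ≤ r₊ + δ}`, from the era's linear collar bound
`|dr(G♯dr)| ≤ κ₁ (r − r₊)` on a `δ₁`-collar (take `δ = min δ₁ (ε/(|κ₁|+1))`). [folklore] -/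
theorem stub_eraHorizonNull :
  ∀ (k : ℕ) (X : Type) [TopologicalSpace X] [ChartedSpace E3 X] [IsManifold (𝓡 3) ∞ X] [T2Space X] [SecondCountableTopology X] [ConnectedSpace X], ∀ D ∈ admissibleVacuumData X, ∀ 𝒟 : VacuumCauchyDevelopment D, 𝒟.IsMaximal → ∀ (O : Set 𝒟.carrier) (N : ℕ) (M a : Fin N → ℝ) (mo : Fin N → lorentzGroup × E4) (τ₀ : ℝ) (Ψ : ∀ i, boostedKerrExterior (mo i).1 (mo i).2 (M i) (a i) → 𝒟.carrier) (ρ R : Fin N → ℝ → ℝ) (U₀ : Opens E4) (Ψ₀ : U₀ → 𝒟.carrier), (∀ i, 0 < M i ∧ |a i| ≤ M i) ∧ (∀ i, 𝒟.toSpacetime.IsLateChart (boostedKerrBackground (mo i).1 (mo i).2 (M i) (a i)) O τ₀ (Ψ i)) ∧ 𝒟.toSpacetime.IsLateChart (Minkowski.backgroundOn U₀) O τ₀ Ψ₀ ∧ (∀ i, Tendsto (fun t ↦ ρ i t / t) atTop (𝓝 0)) ∧ (∀ i, Tendsto (R i) atTop atTop ∧ ∀ τ, max (Kerr.rPlus (M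 i) (a i)) 0 + 1 ≤ R i τ) ∧ {x : E4 | τ₀ < x 0 ∧ ∀ i, ρ i (x 0) < Kerr.radius (a i) (poincareInv (mo i).1 (mo i).2 x)} ⊆ (U₀ : Set E4) ∧ (∀ R' : ℝ, ∃ τ₁ : ℝ, Pairwise (Function.onFun Disjoint fun i ↦ Ψ i '' (boostedKerrBackground (mo i).1 (mo i).2 (M i) (a i)).truncLateRegion τ₁ R')) ∧ O = Summit.FinalStateConjecture.exteriorOf 𝒟.toCauchyDevelopment ((⋃ i, Ψ i '' (boostedKerrBackground (mo i).1 (mo i).2 (M i) (a i)).lateRegion τ₀) ∪ Ψ₀ '' (Minkowski.backgroundOn U₀).lateRegion τ₀) ∧ Summit.FinalStateConjecture.RaysStayInClosure 𝒟.toCauchyDevelopment O ∧ (∀ τ₁ : ℝ, τ₀ < τ₁ → O \ (Ψ₀ '' (Minkowski.backgroundOn U₀).lateRegion τ₁ ∪ ⋃ i, Ψ i '' {x | τ₁ < (boostedKerrBackground (mo i).1 (mo i).2 (M i) (a i)).time x.1 ∧ (boostedKerrBackground (mo i).1 (mo i).2 (M i) (a i)).radius x.1 ≤ R i ((boostedKerrBackground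 (mo i).1 (mo i).2 (M i) (a i)).time x.1)}) ⊆ 𝒟.metric.causalPast 𝒟.timeOrientation (Ψ₀ '' (Minkowski.backgroundOn U₀).timeSlab τ₁ ∪ ⋃ i, Ψ i '' (boostedKerrBackground (mo i).1 (mo i).2 (M i) (a i)).truncTimeSlab (R i τ₁) τ₁)) ∧ ((∀ i, Summit.FinalStateConjecture.IsOrthochronous (mo i).1) ∧ ∀ τ : ℝ, τ₀ < τ → ∀ x ∈ (Minkowski.backgroundOn U₀).timeSlab τ, 𝒟.toSpacetime.timeOrientation.IsFutureDirected (mfderiv 𝓘(ℝ, E4) (𝓡 4) Ψ₀ x (E4.basisVector 0))) ∧ (∀ τ : ℝ, τ₀ < τ → 𝒟.toSpacetime.deviationCk (Minkowski.backgroundOn U₀) Ψ₀ 0 τ ≤ ENNReal.ofReal (1 / 8) ∧ ∀ i, 𝒟.toSpacetime.truncDeviationCk (boostedKerrBackground (mo i).1 (mo i).2 (M i) (a i)) (Ψ i) 0 (R i τ) τ ≤ ENNReal.ofReal (1 / 8)) ∧ (∃ B : NNReal, ∀ τ : ℝ, τ₀ < τ → 𝒟.toSpacetime.deviationCk (Minkowski.backgroundOn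 U₀) Ψ₀ (k + 4) τ ≤ (B : ENNReal)) ∧ (∀ R' : ℝ, ∃ B : NNReal, ∀ τ : ℝ, τ₀ < τ → ∀ i, 𝒟.toSpacetime.truncDeviationCk (boostedKerrBackground (mo i).1 (mo i).2 (M i) (a i)) (Ψ i) (k + 4) R' τ ≤ (B : ENNReal)) ∧ (∀ ε : ℝ, 0 < ε → ∃ Rf : ℝ, ∀ τ : ℝ, τ₀ < τ → supCkENorm (Subtype.val '' {x | x ∈ (Minkowski.backgroundOn U₀).timeSlab τ ∧ Rf ≤ ‖E4.spatial (x : E4)‖}) (k + 4) (𝒟.toSpacetime.deviationExtend (Minkowski.backgroundOn U₀) Ψ₀) ≤ ENNReal.ofReal ε) → (∀ i, ∃ κ₁ δ₁ : ℝ, 0 < δ₁ ∧ ∀ τ : ℝ, τ₀ < τ → ∀ x ∈ (boostedKerrBackground (mo i).1 (mo i).2 (M i) (a i)).truncTimeSlab (Kerr.rPlus (M i) (a i) + δ₁) τ, |((fderiv ℝ (fun y ↦ Kerr.radius (a i) (poincareInv (mo i).1 (mo i).2 y)) (x : E4)) (MetricCoord.sharpAt (fun y ↦ (𝒟.toSpacetime.deviationExtend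 (boostedKerrBackground (mo i).1 (mo i).2 (M i) (a i)) (Ψ i)) y + boostedKerrBilin (mo i).1 (mo i).2 (M i) (a i) y) (x : E4) (fderiv ℝ (fun y ↦ Kerr.radius (a i) (poincareInv (mo i).1 (mo i).2 y)) (x : E4))))| ≤ κ₁ * ((boostedKerrBackground (mo i).1 (mo i).2 (M i) (a i)).radius (x : E4) - Kerr.rPlus (M i) (a i))) → ∀ i, (∀ ε : ℝ, 0 < ε → ∃ δ : ℝ, 0 < δ ∧ ∀ τ : ℝ, τ₀ < τ → ∀ x ∈ (boostedKerrBackground (mo i).1 (mo i).2 (M i) (a i)).truncTimeSlab (Kerr.rPlus (M i) (a i) + δ) τ, |((fderiv ℝ (fun y ↦ Kerr.radius (a i) (poincareInv (mo i).1 (mo i).2 y)) (x : E4)) (MetricCoord.sharpAt (fun y ↦ (𝒟.toSpacetime.deviationExtend (boostedKerrBackground (mo i).1 (mo i).2 (M i) (a i)) (Ψ i)) y + boostedKerrBilin (mo i).1 (mo i).2 (M i) (a i) y) (x : E4) (fderiv ℝ (fun y ↦ Kerr.radius (a i) (poincareInv (mo i).1 (mo i).2 y)) (x : E4))))| ≤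 ε) := by
  intro k X _ _ _ _ _ _ D hD 𝒟 hmax O N M a mo τ₀ Ψ ρ R U₀ Ψ₀ hera hcollar i ε hε
  obtain ⟨κ₁, δ₁, hδ₁, h⟩ := hcollar i
  have hK : 0 < |κ₁| + 1 := by positivity
  refine ⟨min δ₁ (ε / (|κ₁| + 1)), lt_min hδ₁ (div_pos hε hK), fun τ hτ x hx ↦ ?_⟩
  rw [ModelBackground.mem_truncTimeSlab] at hx
  have hx₁ : x ∈ (boostedKerrBackground (mo i).1 (mo i).2 (M i) (a i)).truncTimeSlab
      (Kerr.rPlus (M i) (a i) + δ₁) τ :=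
    ⟨hx.1, hx.2.trans (by linarith [min_le_left δ₁ (ε / (|κ₁| + 1))])⟩
  have hr : Kerr.rPlus (M i) (a i) <
      (boostedKerrBackground (mo i).1 (mo i).2 (M i) (a i)).radius (x : E4) := by
    have hx2 := x.2
    simp only [boostedKerrBackground] at hx2 ⊢
    rw [mem_boostedKerrExterior, Kerr.mem_exterior] at hx2
    exact (le_max_left _ _).trans_lt hx2
  have h0 : 0 ≤ (boostedKerrBackground (mo i).1 (mo i).2 (M i) (a i)).radius (x : E4) -
      Kerr.rPlus (M i) (a i) := by linarith
  have hle : (boostedKerrBackground (mo i).1 (mo i).2 (M i) (a i)).radius (x : E4) -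
      Kerr.rPlus (M i) (a i) ≤ ε / (|κ₁| + 1) := by
    linarith [hx.2, min_le_right δ₁ (ε / (|κ₁| + 1))]
  calc _ ≤ κ₁ * ((boostedKerrBackground (mo i).1 (mo i).2 (M i) (a i)).radius (x : E4) -
        Kerr.rPlus (M i) (a i)) := h τ hτ x hx₁
    _ ≤ |κ₁| * (ε / (|κ₁| + 1)) :=
        (mul_le_mul_of_nonneg_right (le_abs_self κ₁) h0).trans
          (mul_le_mul_of_nonneg_left hle (abs_nonneg κ₁))
    _ ≤ (|κ₁| + 1) * (ε / (|κ₁| + 1)) :=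
        mul_le_mul_of_nonneg_right (by linarith) (div_pos hε hK).le
    _ = ε := mul_div_cancel₀ ε hK.ne'

end Summit.FinalStateConjecture.FinalStateConjecture.Theorems.ClusterCompleteness

end
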